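import Literature.ModelTheory.PseudofiniteFields.DefinableSetsFiniteFields
import Literature.ModelTheory.PseudofiniteFields.DefinableSetsFiniteFieldsTransferProofs
import Literature.ModelTheory.PseudofiniteFields.FiniteFieldTheory
import HarnessLib

/-!
# Algebraic boundedness of pseudo-finite fields (from the CDM size dichotomy)

Z. Chatzidakis, L. van den Dries, A. Macintyre, *Definable sets over finite fields*, J. reine
angew. Math. **427** (1992) 107–135 (bib key ChatzidakisVanDenDriesMacintyre1992). A consequence
of the Main Theorem recorded here as a PROVED corollary of the named fact
`ChatzidakisVanDenDriesMacintyre1992_mainTheorem` (file `DefinableSetsFiniteFields.lean`):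

* `ChatzidakisVanDenDriesMacintyre1992_mainTheorem.infinite_of_injective` — **pseudo-finite
  fields are algebraically bounded**: for every ring formula `φ(x̄; ȳ)` there is `C ∈ ℕ` such
  that in every pseudo-finite field `K` (an infinite model of the theory of finite fields) and
  for all parameters `ȳ`, if the definable set `φ(K^m; ȳ)` has `C + 1` pairwise distinct points
  then it is infinite (cf. van den Dries 1989, "Dimension of definable sets, algebraic
  boundedness and Henselian fields").

Proof (theorems only; no definitions, no named facts). By the size dichotomy
`ChatzidakisVanDenDriesMacintyre1992_mainTheorem.card_le_or_le` there are reals `C₀` and `δ > 0`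
with `|φ(F^m; ȳ)| ≤ C₀` or `|φ(F^m; ȳ)| ≥ δ|F|` for every finite field `F`; put `C = ⌈C₀⌉₊`. For
each `M` the statement "`φ(·; ȳ)` has `C + 1` pairwise distinct realisations → it has `M` pairwise
distinct realisations" is one ring formula in `ȳ` (`exists_formula_injective_realize`), true
identically in every finite field with `δ|F| ≥ M` (`exists_injective_realize_of_card_le`), hence
in every pseudo-finite field by transfer (`realize_formula_of_forall_finite`); a set with `M`
pairwise distinct points for every `M` is infinite.

## References

* [ChatzidakisVanDenDriesMacintyre1992] Z. Chatzidakis, L. van den Dries, A. Macintyre, Definable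
  sets over finite fields, J. reine angew. Math. 427 (1992) 107–135, Main Theorem and p. 110.
-/

namespace Literature.ModelTheory.PseudofiniteFields

open FirstOrder FirstOrder.Language FirstOrder.Ring

universe u

/-- **"`φ(·; ȳ)` has at least `M` pairwise distinct realisations" is a first-order property of
the parameters `ȳ`**, uniformly in all `L_ring`-structures: the formula
`∃ (x_{j,l})_{j<M, l<m} (⋀_{j ≠ j'} ¬ ⋀_l x_{j,l} = x_{j',l}) ∧ ⋀_j φ(x_j; ȳ)`. [folklore] -/
theorem exists_formula_injective_realize (m n M : ℕ)
    (φ : Language.ring.Formula (Fin m ⊕ Fin n)) :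
    ∃ θ : Language.ring.Formula (Fin n),
      ∀ (K : Type u) [Language.ring.Structure K] (y : Fin n → K),
        θ.Realize y ↔
          ∃ w : Fin M → Fin m → K, Function.Injective w ∧ ∀ j, φ.Realize (Sum.elim (w j) y) := by
  refine ⟨Formula.iExs (Fin M × Fin m)
      ((Formula.iInf fun p : {p : Fin M × Fin M // p.1 ≠ p.2} =>
          (Formula.iInf fun l : Fin m =>
            Term.equal (var (Sum.inr (p.1.1, l))) (var (Sum.inr (p.1.2, l)))).not) ⊓
        Formula.iInf fun j : Fin M =>
          φ.relabel (Sum.elim (fun l => Sum.inr (j, l)) Sum.inl)),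
    fun K _ y => ?_⟩
  have hval : ∀ (i : Fin M × Fin m → K) (j : Fin M),
      Sum.elim y i ∘ Sum.elim (fun l => Sum.inr (j, l)) Sum.inl = Sum.elim (fun l => i (j, l)) y :=
    fun i j => funext fun a => by cases a <;> rfl
  simp only [Formula.realize_iExs, Formula.realize_inf, Formula.realize_iInf, Formula.realize_not,
    Formula.realize_equal, Term.realize_var, Sum.elim_inr, Formula.realize_relabel, hval]
  constructor
  · rintro ⟨i, hdist, hφ⟩
    refine ⟨fun j l => i (j, l), fun a b hab => ?_, hφ⟩
    by_contra hne
    exact hdist ⟨(a, b), hne⟩ fun l => congrFun hab l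
  · rintro ⟨w, hw, hφ⟩
    exact ⟨fun p => w p.1 p.2, fun p h => p.2 (hw (funext h)), hφ⟩

/-- **The size dichotomy, counted (finite fields).** If `|φ(F^m; ȳ)| ≤ C₀` or
`|φ(F^m; ȳ)| ≥ δ|F|` (`δ > 0`), the finite field `F` has at least `⌈M/δ⌉₊` elements, and
`φ(·; ȳ)` has `⌈C₀⌉₊ + 1` pairwise distinct realisations, then it has `M` pairwise distinct
realisations. [cite: ChatzidakisVanDenDriesMacintyre1992, Main Theorem] -/
theorem exists_injective_realize_of_card_le {F : Type} [Field F] [Fintype F] {m n : ℕ}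
    (φ : Language.ring.Formula (Fin m ⊕ Fin n)) (y : Fin n → F) {C₀ δ : ℝ} (hδ : 0 < δ)
    (hdich : (definableCard F φ y : ℝ) ≤ C₀ ∨
      δ * (Fintype.card F : ℝ) ≤ (definableCard F φ y : ℝ))
    {M : ℕ} (hF : ⌈(M : ℝ) / δ⌉₊ ≤ Fintype.card F)
    (w : Fin (⌈C₀⌉₊ + 1) → Fin m → F) (hw : Function.Injective w)
    (hφ : ∀ j, (letI := compatibleRingOfRing F; φ.Realize (Sum.elim (w j) y))) :
    ∃ w' : Fin M → Fin m → F, Function.Injective w' ∧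
      ∀ j, (letI := compatibleRingOfRing F; φ.Realize (Sum.elim (w' j) y)) := by
  letI := compatibleRingOfRing F
  rw [definableCard_def] at hdich
  set S := {x : Fin m → F // φ.Realize (Sum.elim x y)} with hS
  -- `C₀ < ⌈C₀⌉₊ + 1 ≤ |S|`, so the first alternative fails
  have hlow : ⌈C₀⌉₊ + 1 ≤ Nat.card S := by
    have h := Nat.card_le_card_of_injective (fun j => (⟨w j, hφ j⟩ : S))
      (fun a b hab => hw (congrArg Subtype.val hab))
    rwa [Nat.card_fin] at h
  have hMle : M ≤ Nat.card S := by
    rcases hdich with h1 | h2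
    · exfalso
      have h3 : (⌈C₀⌉₊ : ℝ) + 1 ≤ (Nat.card S : ℝ) := by exact_mod_cast hlow
      linarith [Nat.le_ceil C₀]
    · have h4 : (M : ℝ) / δ ≤ (Fintype.card F : ℝ) :=
        (Nat.le_ceil _).trans (by exact_mod_cast hF)
      have h5 : (M : ℝ) ≤ δ * (Fintype.card F : ℝ) := by
        rw [div_le_iff₀ hδ] at h4
        linarith
      exact_mod_cast h5.trans h2
  refine ⟨fun j => ((Finite.equivFin S).symm (Fin.castLE hMle j)).1, fun a b hab => ?_,
    fun j => ((Finite.equivFin S).symm (Fin.castLE hMle j)).2⟩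
  exact Fin.castLE_injective hMle ((Finite.equivFin S).symm.injective (Subtype.val_injective hab))

/-- **Algebraic boundedness of pseudo-finite fields**: a definable set with more than `C` points
is infinite — for every ring formula `φ(x̄; ȳ)` there is `C ∈ ℕ` such that in every pseudo-finite
field `K` (an infinite field satisfying every sentence true in all finite fields) and for all
parameters `ȳ ∈ K^n`, if `φ(K^m; ȳ)` contains `C + 1` pairwise distinct points then it is
infinite. This is the CDM size dichotomy "`|φ(F^m; ȳ)| ≤ C₀` or `≥ δ|F|`" for finite fields `F`,
transferred: "`C + 1` distinct points ⇒ `M` distinct points" is a ring formula in `ȳ` true in all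
finite fields with `δ|F| ≥ M`, hence in `K`, for every `M` (cf. van den Dries 1989, algebraic
boundedness). [cite: ChatzidakisVanDenDriesMacintyre1992, Main Theorem] -/
theorem ChatzidakisVanDenDriesMacintyre1992_mainTheorem.infinite_of_injective
    (hCDM : ChatzidakisVanDenDriesMacintyre1992_mainTheorem) (m n : ℕ)
    (φ : Language.ring.Formula (Fin m ⊕ Fin n)) :
    ∃ C : ℕ, ∀ (K : Type) [Field K] [CompatibleRing K] [Infinite K], K ⊨ finiteFieldTheory →
      ∀ (y : Fin n → K) (w : Fin (C + 1) → (Fin m → K)), Function.Injective w →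
        (∀ j, φ.Realize (Sum.elim (w j) y)) →
          {x : Fin m → K | φ.Realize (Sum.elim x y)}.Infinite := by
  obtain ⟨C₀, δ, hδ, hdich⟩ := hCDM.card_le_or_le m n φ
  refine ⟨⌈C₀⌉₊, fun K _ _ _ hK y w hw hφw => ?_⟩
  -- for every `M`, the set has `M` pairwise distinct points (transfer of the counted dichotomy)
  have hM : ∀ M : ℕ, ∃ w' : Fin M → Fin m → K, Function.Injective w' ∧
      ∀ j, φ.Realize (Sum.elim (w' j) y) := by
    intro M
    obtain ⟨θ₁, hθ₁⟩ := exists_formula_injective_realize.{0} m n (⌈C₀⌉₊ + 1) φ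
    obtain ⟨θ₂, hθ₂⟩ := exists_formula_injective_realize.{0} m n M φ
    have h := realize_formula_of_forall_finite (θ₁.imp θ₂) ⌈(M : ℝ) / δ⌉₊
      (fun F _ _ hF v => by
        letI := compatibleRingOfRing F
        rw [Formula.realize_imp, hθ₁, hθ₂]
        rintro ⟨w₁, hw₁, hφ₁⟩
        exact exists_injective_realize_of_card_le φ v hδ (hdich F v) hF w₁ hw₁ hφ₁) K hK y
    rw [Formula.realize_imp, hθ₁, hθ₂] at h
    exact h ⟨w, hw, hφw⟩
  -- hence it is infinite
  intro hfin
  haveI := hfin.to_subtype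
  obtain ⟨w', hw', hφ'⟩ := hM (Nat.card {x : Fin m → K | φ.Realize (Sum.elim x y)} + 1)
  have h := Nat.card_le_card_of_injective
    (fun j => (⟨w' j, hφ' j⟩ : {x : Fin m → K | φ.Realize (Sum.elim x y)}))
    (fun a b hab => hw' (congrArg Subtype.val hab))
  rw [Nat.card_fin] at h
  exact Nat.lt_irrefl _ (Nat.lt_of_succ_le h)

end Literature.ModelTheory.PseudofiniteFields
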